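import Literature.IUT.HodgeArakelov.ThetaEnvDataRecordAutSaturatedOfGalois
import Literature.IUT.HodgeArakelov.EtaleThetaDataOfSettingRootHypOfCor28iIntrinsicInner

/-!
# [IUTchII] Prop 3.4 (i) at the GENUINE data — node statement of record with the root binder (P4) `hroot` SUPPLIED
# ALONG ROUTE 2, COMPANION-FREE ([EtTh] Prop 2.4 (F-0609) + Cor 2.8 (i) (F-0640) at `ofEmbedding`, Π-intrinsic glue)

S. Mochizuki, *Inter-universal Teichmüller theory II*, kurims manuscript (Dec. 2020): Prop 3.4 (i) pp. 91–92
[cite: Mochizuki2012, Prop 3.4 (i) p.91]; Prop 1.4 p. 27.  Claim key DISPUTED (D-0012).  Refereed inputs BY NAME ([EtTh] =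
S. Mochizuki, Publ. RIMS **45** (2009)): Cor. 2.18 (i) p. 60 (= FACT F-0620), Prop. 2.4 p. 38 (= FACT F-0609
`TemperedCoverData.Prop24`), Cor. 2.8 (i) p. 42 (= FACT F-0640 `ThetaOrbitData.Cor28_i`) [cite: MochizukiEtTh2009, Cor 2.8(i) p.42].
abc-iut cell (block C / W6 seat abc-iut-w6-d051 gen 4); node IUTchII:Prop3.4(i) (holder lineage abc-iut-w5-d169;
`plan/L6/SUBDAG-IUTchII-Prop-31-33-34.md`); GAP-LEDGER row G-w5d169-2 (binder (P4) `hroot`).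

PROOF-ONLY assembly (no definition, no `Prop`-valued fact, nothing restated) — the COMPANION-FREE twin of abc-iut-w5-d169's
`ThetaEnvDataRecordAutSaturatedOfCor28i` (p444361): this lineage's statement of record
`EtaleLevels.prop34i_multiradiallyDefined_saturated_ofGalois` (p437226) with (P4) `hroot` := abc-iut-w6-d051's
`EtaleThetaDataOfSetting.rootHyp_of_cor28_i_intrinsic_innerAdjust` (p446492): per `α`, extend `α⁻¹` through `ι` by F-0609
to a tower-stabilising `Γ ∈ Aut_top(Π^tp_C)`, adjust by an inner `γ_{ι u}` into a `Dtau`-stabilising one (`hDtau'`,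
abc-iut-w5-d118's v2-A shape, FINDING F-w5d118g5-1), take the induced `Γ_Θ` (`hInd`), apply F-0640 and compare its
transport DIRECTLY with abc-iut-w5-d169's Π-intrinsic `autActTopOfCor218i α` (p445736) — no restriction of `Γ` to `Π^tp_X`,
no theta companion.  Binder delta versus p444361 (v2): `hιX : range ι = T.tp T.PiX` and `hΔ : ∀ γ, γ(Δ^tp_X) = Δ^tp_X`
DROPPED; `hInd : ∀ tower-stabilising Γ ∃ Γ_Θ, InducesOnTheta Γ Γ_Θ` ADDED (it follows from the two dropped binders by
abc-iut-w5-d118's `exists_inducesOnTheta_of_companion`, so the list is by-name weaker); the statement of record's binder `hcharY`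
(`PiYddCharacteristic C`) is DISCHARGED here from F-0620 by abc-iut-w4-d013's `piYddCharacteristic_of_cor218_i`.
* **`EtaleLevels.prop34i_multiradiallyDefined_saturated_ofCor28iIntrinsic`**, **`…exists_coeff_…_ofCor28iIntrinsic`**.
Nothing here asserts anything of [IUTchII] or [EtTh]; no side taken on [IUTchIII] Cor 3.12; typed ≠ proved for the binders.
-/

noncomputable section

open Topology

namespace Literature.IUT.HodgeArakelov

open Literature.AnabelianGeometry.EtaleTheta Literature.AnabelianGeometry.SemiGraphs
open CohomologySystemOfContH1 EtaleThetaDataOfSetting TemperedThetaMonoids ThetaCovers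
open scoped Literature.AnabelianGeometry.EtaleTheta

namespace EtaleLevels

universe u

variable {p : ℕ} [Fact p.Prime] {D : Literature.AnabelianGeometry.EtaleTheta.ThetaSetting p}
  {E : D.EtaleThetaData} {l : ℕ} (C : E.DoubleUnderline l) (hC : D.Compat) (hS : D.Sec2Hyps)
  (hl : l.Prime) (hp2 : p ≠ 2) (hpl : p ≠ l) (hζ : ∃ ζ : D.K, IsPrimitiveRoot ζ (4 * l))
  (mods : ∀ M : ℕ+, D.CyclotomeMod l M)
  (f : contCocycles D.toTheta D.DeltaTheta C.GtpYdduu) (hf : f ∈ C.rootCocycles hC)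
  (hmods : ∀ (M M' : ℕ+) (h : (M : ℕ) ∣ (M' : ℕ)) (x : D.lDeltaTheta l),
    MuN.red p M M' h ((mods M').red x) = (mods M).red x)
  (h15 : Literature.AnabelianGeometry.EtaleTheta.ThetaSetting.Prop15iii E hC) (L : C.CuspLabels)
  (hZ : ∀ M : ℕ+, Nonempty (ModelCyclotomes.lDeltaQuot (C.rigidData (mods M) hC hS h15 L) ≃*
    Literature.IUT.HodgeTheaters.ZHat))
  (hlim : Function.Bijective (rigidLimHom C hC hS hl hp2 hpl hζ mods f hf hmods h15 L hZ))
  [(EtaleThetaDataOfSetting.PiYdd C).Normal]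
  (hq : IsQuotientMap D.toTheta) {N : ℕ+} (μ : D.CyclotomeMod l N)
  (R : RigidData.{0} N l) (hR : R = C.rigidData μ hC hS h15 L) (h218i : R.Cor218_i)
  -- ROUTE 2, COMPANION-FREE inputs (abc-iut-w6-d051 `rootHyp_of_cor28_i_intrinsic_innerAdjust`, p446492)
  {T : TemperedCoverData.{u} l} (ε : C.OrbitEmbedding T)
  (hιe : IsOpenEmbedding ε.ι) (h24 : T.Prop24) (hstd : (ThetaOrbitData.ofEmbedding ε hC hS).IsStandard)
  (h28 : (ThetaOrbitData.ofEmbedding ε hC hS).Cor28_i)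
  (hDtau' : ∀ Γ : T.Gtp ≃ₜ* T.Gtp, (∀ S ∈ T.tower, S.map Γ.toMulEquiv.toMonoidHom = S) →
    ∃ u ∈ C.Huu, ∀ Dt ∈ (ThetaOrbitData.ofEmbedding ε hC hS).Dtau,
      Dt.map (Γ.trans (ThetaOrbitData.innerAutTop (ε.ι u))).toMulEquiv.toMonoidHom ∈
        (ThetaOrbitData.ofEmbedding ε hC hS).Dtau)
  (hInd : ∀ Γ : T.Gtp ≃ₜ* T.Gtp, (∀ S ∈ T.tower, S.map Γ.toMulEquiv.toMonoidHom = S) →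
    ∃ ΓΘ : (ThetaOrbitData.ofEmbedding ε hC hS).DeltaTheta ≃* (ThetaOrbitData.ofEmbedding ε hC hS).DeltaTheta,
      (ThetaOrbitData.ofEmbedding ε hC hS).InducesOnTheta Γ ΓΘ)
  -- index / constants / origin / (P3)
  (ι₀ : (Pi C) ≃ₜ* (Pi C))
  {Es : Set ℕ+} (τw : D.CyclotomeTower l Es)
  (O : Submonoid (PadicAlgCl p)ˣ)
  (hO : ∀ (σ : GQp p) (u : (PadicAlgCl p)ˣ), u ∈ O → Units.map (σ : PadicAlgCl p →* PadicAlgCl p) u ∈ O)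
  (hO' : D.IsEtThOrigin)
  (hgal : ∀ α : (Pi C) ≃ₜ* (Pi C), ∃ τ : GQp p,
    (∀ x : Pi C, aug C (α x) = τ * aug C x * τ⁻¹) ∧
    (∀ (M : ℕ+) (z w : D.lDeltaTheta l),
      ((rangeAutOfCor218i C μ hq hC hS h15 L R hR h218i α
          ⟨(z : D.GtpTheta), lDeltaTheta_le_phiRange C z.2⟩ : phiRange C) : D.GtpTheta) = (w : D.GtpTheta) →
        (τw.modAll M).red w = galMuN p M τ ((τw.modAll M).red z)))

/-- **[IUTchII] Prop 3.4 (i) — MULTIRADIALITY OF SPLIT THETA MONOIDS AT THE GENUINE FUNCTOR, root binder along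
ROUTE 2, COMPANION-FREE**: (P1) := {F-0620, `hq`}; (P2) none (saturated index set); (P3) := `hgal`; (P4) := `hroot` FROM
F-0609 (`h24`) + F-0640 (`h28`, `hstd`, `hDtau'` inner-adjusted) + `hInd` along the orbit embedding `ε` (`hιe`) — NO
`range ι = T.tp T.PiX`, NO `γ(Δ^tp_X) = Δ^tp_X`, NO theta companion (abc-iut-w6-d051's
`rootHyp_of_cor28_i_intrinsic_innerAdjust`). [cite: Mochizuki2012, Prop 3.4 (i) p.92] -/
theorem prop34i_multiradiallyDefined_saturated_ofCor28iIntrinsic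
    (c : CyclotomeCoefficients (phi C) (D.lDeltaTheta l) (PadicAlgCl p)ˣ)
    (hlev : ∀ (ζ : cyclotome (PadicAlgCl p)ˣ) (M : ℕ+),
      (((τw.modAll M).red (c.hom ζ) : MuN p M) : (PadicAlgCl p)ˣ) = (ζ : ℕ+ → (PadicAlgCl p)ˣ) M)
    {η : (C.thetaEnvData μ hC hS).PiYdd → MuN p N} (hη : η ∈ (C.thetaEnvData μ hC hS).thetaCocycles)
    (Γ : Type) [Group Γ] :
    haveI := hC.GtpYdd_normal
    ((ex18iii (ThetaSetting.ofDoubleUnderline C μ hC hS hl hp2 hpl hζ hη) Γ).toDagger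
      (TemperedThetaMonoids.prop34iRadialFunctor
        (thetaEnvTransportS C hC hS hl hp2 hpl hζ mods f hf hmods h15 L hZ
          (piYddCharacteristic_of_cor218_i C μ hC hS h15 L R hR h218i) hlim hq μ R hR h218i
          (h1LimKummerOn (phi C) (D.lDeltaTheta l) (PiYdd C) c (isOpen_stabilizer_units C)
            (finiteIndex_stabilizer_units C) O) ι₀
          (map_mrange_h1LimKummerOn_eq_of_galois C hq μ τw c hlev O hO hC hS h15 L R hR h218i hO' hgal)
          (image_toLim_theta_thetaEnvData_of_rootHyp C hC hS hl hp2 hpl hζ mods f hf hmods h15 L hZ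
          (piYddCharacteristic_of_cor218_i C μ hC hS h15 L R hR h218i) hlim hq
            μ R hR h218i
            (fun α => rootHyp_of_cor28_i_intrinsic_innerAdjust C hq α ε μ hC hS h15 L R hR h218i hιe h24 hstd h28
              hDtau' hInd))
          (image_thetaInfty_thetaEnvData_of_rootHyp C hC hS hl hp2 hpl hζ mods f hf hmods h15 L hZ
          (piYddCharacteristic_of_cor218_i C μ hC hS h15 L R hR h218i) hlim hq μ
            R hR h218i
            (fun α => rootHyp_of_cor28_i_intrinsic_innerAdjust C hq α ε μ hC hS h15 L R hR h218i hιe h24 hstd h28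
              hDtau' hInd)) hη)
        Γ)).IsMultiradiallyDefined := by
  haveI := hC.GtpYdd_normal
  exact prop34i_multiradiallyDefined_saturated_ofGalois C hC hS hl hp2 hpl hζ mods f hf hmods h15 L hZ
          (piYddCharacteristic_of_cor218_i C μ hC hS h15 L R hR h218i) hlim hq μ
    R hR h218i
    (fun α => rootHyp_of_cor28_i_intrinsic_innerAdjust C hq α ε μ hC hS h15 L R hR h218i hιe h24 hstd h28 hDtau' hInd)
    ι₀ τw O hO hO' hgal c hlev hη Γ

/-- **The same with the coefficient datum DISCHARGED** (`exists_cyclotomeCoefficients_of_cyclotomeTower` under `hO'` +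
`hΔc`): residual BY NAME {F-0620, F-0609, F-0640, `hq`, `hO'`, `hΔc`, `hιe`, `hstd`, `hDtau'`, `hInd`, `hgal`} plus the
standing record/tower inputs (no `hcharY`: derived from F-0620). [cite: Mochizuki2012, Prop 3.4 (i) p.92] -/
theorem exists_coeff_prop34i_multiradiallyDefined_saturated_ofCor28iIntrinsic
    (hΔc : IsCompact (D.DeltaTheta : Set D.GtpTheta))
    {η : (C.thetaEnvData μ hC hS).PiYdd → MuN p N} (hη : η ∈ (C.thetaEnvData μ hC hS).thetaCocycles)
    (Γ : Type) [Group Γ] :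
    haveI := hC.GtpYdd_normal
    ∃ (c : CyclotomeCoefficients (phi C) (D.lDeltaTheta l) (PadicAlgCl p)ˣ)
      (hlev : ∀ (ζ : cyclotome (PadicAlgCl p)ˣ) (M : ℕ+),
        (((τw.modAll M).red (c.hom ζ) : MuN p M) : (PadicAlgCl p)ˣ) = (ζ : ℕ+ → (PadicAlgCl p)ˣ) M),
      Function.Bijective c.hom ∧
      ((ex18iii (ThetaSetting.ofDoubleUnderline C μ hC hS hl hp2 hpl hζ hη) Γ).toDagger
        (TemperedThetaMonoids.prop34iRadialFunctor
          (thetaEnvTransportS C hC hS hl hp2 hpl hζ mods f hf hmods h15 L hZ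
          (piYddCharacteristic_of_cor218_i C μ hC hS h15 L R hR h218i) hlim hq μ R hR h218i
            (h1LimKummerOn (phi C) (D.lDeltaTheta l) (PiYdd C) c (isOpen_stabilizer_units C)
              (finiteIndex_stabilizer_units C) O) ι₀
            (map_mrange_h1LimKummerOn_eq_of_galois C hq μ τw c hlev O hO hC hS h15 L R hR h218i hO' hgal)
            (image_toLim_theta_thetaEnvData_of_rootHyp C hC hS hl hp2 hpl hζ mods f hf hmods h15 L hZ
          (piYddCharacteristic_of_cor218_i C μ hC hS h15 L R hR h218i) hlim hq
              μ R hR h218i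
              (fun α => rootHyp_of_cor28_i_intrinsic_innerAdjust C hq α ε μ hC hS h15 L R hR h218i hιe h24 hstd h28
              hDtau' hInd))
            (image_thetaInfty_thetaEnvData_of_rootHyp C hC hS hl hp2 hpl hζ mods f hf hmods h15 L hZ
          (piYddCharacteristic_of_cor218_i C μ hC hS h15 L R hR h218i) hlim hq
              μ R hR h218i
              (fun α => rootHyp_of_cor28_i_intrinsic_innerAdjust C hq α ε μ hC hS h15 L R hR h218i hιe h24 hstd h28
              hDtau' hInd)) hη)
          Γ)).IsMultiradiallyDefined := by
  haveI := hC.GtpYdd_normal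
  exact exists_coeff_prop34i_multiradiallyDefined_saturated_ofGalois C hC hS hl hp2 hpl hζ mods f hf hmods h15 L hZ
    (piYddCharacteristic_of_cor218_i C μ hC hS h15 L R hR h218i) hlim hq μ R hR h218i
    (fun α => rootHyp_of_cor28_i_intrinsic_innerAdjust C hq α ε μ hC hS h15 L R hR h218i hιe h24 hstd h28 hDtau' hInd)
    ι₀ τw O hO hO' hgal hΔc hη Γ

end EtaleLevels

end Literature.IUT.HodgeArakelov

end
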